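import Summits.QuantumFields.YangMills.Theorems.SwapVirialDeficitBlowUpGnomonicHubShiftSmooth
import Summits.QuantumFields.YangMills.Theorems.SwapVirialDeficitBlowUpGnomonicStratumBEtaCoercivity
import HarnessLib

/-!
# THE HUB-POLAR DIRECTION OF THE B-FIBRE IS STIFF: `2·(4δ′²/‖a‖²)·(4|u|²/(1+|u|²))/16200L⁶ ≤ (d²/ds²)F̂(a − (sδ′)·1, ε, η_B + s·ξ_B(d))|₀`
# (free-hands support of ⟨stmt-QuantumFields-24197⟩ `SwapVirialDeficit.SwapGluedStiffness`; region (Rd) of LEAD g98's skeleton ➎ — last B-fibre direction; with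
# ✓`fibre_raySecond_ge_stratumB_diag` every direction of fibre_B = (δ, x₀′, y′, z′, η_F′) is now stiff off the crossing `Σ = {u = 0}`)

At an END hub (`re a = 0`) the hub word `[c², C₀]` of ✓`leadersW_hubStiff_le` carries `(2A₀A₁)²·gnoWtr(η_x)` with `A₀ = re/‖·‖`: along the real hub shift `a(s) = a − (sδ′)·1`
(`re a(s) = −sδ′`, `im` fixed, `‖a(s)‖² = s²δ′² + ‖im a‖²`) this is `s²·h(s)` with `h(0) = (4δ′²/‖im a‖²)·gnoWtr((0,u))`, a touching minorant of the joint ray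
(✓`contDiff_gnoDeficit_hubShift_ray`, ✓`gnoDeficit_stratumB_eq_zero`, ✓`iteratedDeriv_two_ge_of_minorant`):
* `normSq_hubShift` (`‖a − c·1‖² = c² + ‖im a‖²` for `re a = 0`), `hubStiff_hubShift_eq`;
* ★★★ `fibre_raySecond_ge_stratumB_hubPolar (ha : a.im ≠ 0) (hre : a.re = 0) (ε) (hz) (hε) (u₁ u₂ δ d)`:
  `2·((4δ²/‖im a‖²)·(4|u|²/(1+|u|²))/16200L⁶) ≤ iteratedDeriv 2 (s ↦ F̂(a − (sδ)·1, ε, η_B + s·ξ_B(d))) 0`.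

HONEST LABEL: one-variable calculus on a landed inequality; regions' stiffness, ⟨24197⟩ ∕ ⟨24194⟩ ∕ ⟨24497⟩ OPEN; own crux ⟨22884⟩ OPEN (blocked-on ⟨19935⟩); the Yang–Mills mass gap
is NOT proved; no summit is proved by a line.  THEOREMS ONLY (0 `def`, 0 `sorry`), standard axioms.  Width seat ym-line-sfw-p2-w3 g66 (cell ym-idea-1, free hands),
`--supports stmt-QuantumFields-24197`.  References: [cite: Luscher1983, §2]; [folklore].
-/

set_option autoImplicit false

noncomputable section

open MeasureTheory Quaternion
open scoped BigOperators Quaternion ContDiff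
open Literature.MathematicalPhysics.QuantumFieldTheory hiding SU2
open Literature.MathematicalPhysics.QuantumLattice

namespace Summit.QuantumFields.YangMills.Theorems.SwapVirialDeficit.BlowUpRing

open Summit.QuantumFields.YangMills.Theorems.FemtoTransferGap
open Summit.QuantumFields.YangMills.Theorems.SwapVirialDeficit.Gnomonic (normSq3 gnomonicW gnomonicW_nonneg_le contDiff_gnoDeficit_hubShift_ray im_sub_smul_one sub_smul_one_ne_zero)
open Summit.QuantumFields.YangMills.Theorems.QuantitativeLaplace (iteratedDeriv_two_ge_of_minorant iteratedDeriv_two_sq_mul contDiff_sq_mul)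

variable {L : ℕ} [NeZero L]

omit [NeZero L] in
/-- `‖a − c·1‖² = c² + ‖im a‖²` for an end hub `re a = 0`. [folklore] -/
theorem normSq_hubShift {a : ℍ} (hre : a.re = 0) (c : ℝ) : ‖a - c • (1 : ℍ)‖ ^ 2 = c ^ 2 + ‖a.im‖ ^ 2 := by
  rw [sq, sq ‖a.im‖, ← Quaternion.normSq_eq_norm_mul_self, ← Quaternion.normSq_eq_norm_mul_self, Quaternion.normSq_def', Quaternion.normSq_def']
  simp [hre]
  ring

omit [NeZero L] in
/-- The hub-word coefficient along the shift: `(2A₀A₁)² = c²·(4‖im a‖²/(c² + ‖im a‖²)²)` at `a − c·1` (`re a = 0`, `im a ≠ 0`). [folklore] -/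
theorem hubStiff_hubShift_eq {a : ℍ} (ha : a.im ≠ 0) (hre : a.re = 0) (c : ℝ) :
    (2 * (‖a - c • (1 : ℍ)‖⁻¹ * (a - c • (1 : ℍ)).re) * (‖a - c • (1 : ℍ)‖⁻¹ * ‖(a - c • (1 : ℍ)).im‖)) ^ 2 =
      c ^ 2 * (4 * ‖a.im‖ ^ 2 / (c ^ 2 + ‖a.im‖ ^ 2) ^ 2) := by
  have hN : ‖a - c • (1 : ℍ)‖ ≠ 0 := norm_ne_zero_iff.2 (sub_smul_one_ne_zero ha c)
  have hN2 := normSq_hubShift hre c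
  have hre' : (a - c • (1 : ℍ)).re = -c := by simp [hre]
  rw [im_sub_smul_one, hre']
  have hpos : 0 < c ^ 2 + ‖a.im‖ ^ 2 := by
    have : 0 < ‖a.im‖ := norm_pos_iff.2 ha
    positivity
  rw [← hN2]
  field_simp
  ring

set_option maxHeartbeats 800000 in
/-- ★★★ **THE HUB-POLAR DIRECTION IS STIFF AT A B POINT** (end hub: `im a ≠ 0`, `re a = 0`; `ε_z = +`, followers `+`; base letter `u`; any letter direction `d`, hub speed `δ`):
`2·((4δ²/‖im a‖²)·(4|u|²/(1+|u|²))/16200L⁶) ≤ iteratedDeriv 2 (s ↦ F̂(a − (sδ)·1, ε, η_B + s·ξ_B(d))) 0`. [cite: Luscher1983, §2] -/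
theorem fibre_raySecond_ge_stratumB_hubPolar {a : ℍ} (ha : a.im ≠ 0) (hre : a.re = 0) (ε : GnoSign L) (hz : ε.2.1 = true) (hε : ε.2.2 = fun _ => true)
    (u₁ u₂ δ : ℝ) (d : ℝ × (Fin 3 → ℝ) × (Fin 3 → ℝ) × (Fol L → Fin 3 → ℝ)) :
    2 * ((4 * δ ^ 2 / ‖a.im‖ ^ 2) * (4 * (u₁ ^ 2 + u₂ ^ 2) / (1 + (u₁ ^ 2 + u₂ ^ 2))) / (16200 * (L : ℝ) ^ 6)) ≤
      iteratedDeriv 2 (fun s : ℝ => gnoDeficit (fun _ => false) (fun _ => 1) (a - (s * δ) • (1 : ℍ)) ε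
        (((((![0, u₁, u₂] : Fin 3 → ℝ), (0 : Fin 3 → ℝ)), ((0 : Fin 3 → ℝ), (0 : Fol L → Fin 3 → ℝ))) : GnoCoord L) +
          s • ((((![d.1, 0, 0] : Fin 3 → ℝ), d.2.1), (d.2.2.1, d.2.2.2)) : GnoCoord L))) 0 := by
  have hL : (0 : ℝ) < L := by exact_mod_cast NeZero.pos L
  have him : 0 < ‖a.im‖ := norm_pos_iff.2 ha
  have ha0 : a ≠ 0 := by intro h; apply ha; rw [h]; rfl
  -- the `h` function and the ray
  set h : ℝ → ℝ := fun s => (4 * ‖a.im‖ ^ 2 / ((s * δ) ^ 2 + ‖a.im‖ ^ 2) ^ 2 * δ ^ 2) *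
      (4 * (u₁ ^ 2 + u₂ ^ 2) / (1 + ((s * d.1) ^ 2 + (u₁ ^ 2 + u₂ ^ 2)))) / (16200 * (L : ℝ) ^ 6) with hh
  set φ : ℝ → ℝ := fun s : ℝ => gnoDeficit (fun _ => false) (fun _ => 1) (a - (s * δ) • (1 : ℍ)) ε
      (((((![0, u₁, u₂] : Fin 3 → ℝ), (0 : Fin 3 → ℝ)), ((0 : Fin 3 → ℝ), (0 : Fol L → Fin 3 → ℝ))) : GnoCoord L) +
        s • ((((![d.1, 0, 0] : Fin 3 → ℝ), d.2.1), (d.2.2.1, d.2.2.2)) : GnoCoord L)) with hφ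
  -- smoothness
  have hq1 : ContDiff ℝ ∞ fun s : ℝ => (s * δ) ^ 2 + ‖a.im‖ ^ 2 := ((contDiff_id.mul contDiff_const).pow 2).add contDiff_const
  have hq1ne : ∀ s : ℝ, ((s * δ) ^ 2 + ‖a.im‖ ^ 2) ^ 2 ≠ 0 := fun s => by positivity
  have hq2 : ContDiff ℝ ∞ fun s : ℝ => 1 + ((s * d.1) ^ 2 + (u₁ ^ 2 + u₂ ^ 2)) := contDiff_const.add (((contDiff_id.mul contDiff_const).pow 2).add contDiff_const)
  have hq2ne : ∀ s : ℝ, 1 + ((s * d.1) ^ 2 + (u₁ ^ 2 + u₂ ^ 2)) ≠ 0 := fun s => by positivity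
  have hhd : ContDiff ℝ ∞ h := by
    refine ContDiff.div_const ?_ _
    exact ((contDiff_const.div (hq1.pow 2) hq1ne).mul contDiff_const).mul (contDiff_const.div hq2 hq2ne)
  have hφd : ContDiff ℝ ∞ φ := contDiff_gnoDeficit_hubShift_ray (L := L) (fun _ => false) (fun _ => 1) ha ε δ _ _ (n := ⊤)
  -- touching at the B point
  have hφ0 : φ 0 = 0 := by
    simp only [hφ, zero_mul, zero_smul, sub_zero, add_zero]
    exact gnoDeficit_stratumB_eq_zero ha0 hre ε hz hε u₁ u₂
  -- the minorant `s² h(s) ≤ φ s`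
  have hmin : ∀ s, s ^ 2 * h s ≤ φ s := by
    intro s
    have has : a - (s * δ) • (1 : ℍ) ≠ 0 := sub_smul_one_ne_zero ha (s * δ)
    have hfl := leadersW_hubStiff_le (L := L) has ε
      (((((![0, u₁, u₂] : Fin 3 → ℝ), (0 : Fin 3 → ℝ)), ((0 : Fin 3 → ℝ), (0 : Fol L → Fin 3 → ℝ))) : GnoCoord L) +
        s • ((((![d.1, 0, 0] : Fin 3 → ℝ), d.2.1), (d.2.2.1, d.2.2.2)) : GnoCoord L))
    obtain ⟨e1, -, -, -⟩ := stratumB_ray_letters (L := L) u₁ u₂ s (d := d)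
    rw [e1, hubStiff_hubShift_eq ha hre] at hfl
    -- the `x`-weight along the ray
    have ew : gnoWtr ((![0, u₁, u₂] : Fin 3 → ℝ) + s • ![d.1, 0, 0]) = 4 * (u₁ ^ 2 + u₂ ^ 2) / (1 + ((s * d.1) ^ 2 + (u₁ ^ 2 + u₂ ^ 2))) := by
      simp only [gnoWtr, Fin.sum_univ_three, Pi.add_apply, Pi.smul_apply, smul_eq_mul, Matrix.cons_val_zero, Matrix.cons_val_one, Matrix.cons_val_two,
        Matrix.head_cons, Matrix.tail_cons, mul_zero, add_zero, zero_add]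
      ring_nf
    rw [ew] at hfl
    -- drop the nonnegative `y`, `z` terms
    have hy0 : 0 ≤ (‖a - (s * δ) • (1 : ℍ)‖⁻¹ * ‖(a - (s * δ) • (1 : ℍ)).im‖) ^ 2 *
        gnoWtr ((((((![0, u₁, u₂] : Fin 3 → ℝ), (0 : Fin 3 → ℝ)), ((0 : Fin 3 → ℝ), (0 : Fol L → Fin 3 → ℝ))) : GnoCoord L) +
          s • ((((![d.1, 0, 0] : Fin 3 → ℝ), d.2.1), (d.2.2.1, d.2.2.2)) : GnoCoord L)).1.2) := mul_nonneg (sq_nonneg _) (gnoWtr_nonneg_le _).1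
    have hz0 : 0 ≤ gnomonicW ((((((![0, u₁, u₂] : Fin 3 → ℝ), (0 : Fin 3 → ℝ)), ((0 : Fin 3 → ℝ), (0 : Fol L → Fin 3 → ℝ))) : GnoCoord L) +
          s • ((((![d.1, 0, 0] : Fin 3 → ℝ), d.2.1), (d.2.2.1, d.2.2.2)) : GnoCoord L)).2.1) := (gnomonicW_nonneg_le _).1
    have h16 : (0 : ℝ) < 16200 * (L : ℝ) ^ 6 := by positivity
    show s ^ 2 * h s ≤ gnoDeficit (fun _ => false) (fun _ => 1) (a - (s * δ) • (1 : ℍ)) ε _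
    unfold gnoDeficit
    have key : s ^ 2 * h s * (16200 * (L : ℝ) ^ 6) = (s * δ) ^ 2 * (4 * ‖a.im‖ ^ 2 / ((s * δ) ^ 2 + ‖a.im‖ ^ 2) ^ 2) *
        (4 * (u₁ ^ 2 + u₂ ^ 2) / (1 + ((s * d.1) ^ 2 + (u₁ ^ 2 + u₂ ^ 2)))) := by
      simp only [hh]; field_simp
    have : s ^ 2 * h s * (16200 * (L : ℝ) ^ 6) ≤ 16200 * (L : ℝ) ^ 6 * chartDeficit L (fun _ => false) (fun _ => 1)
        (blowUpPoint 1 (gnomonicPoint (a - (s * δ) • (1 : ℍ)) ε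
          (((((![0, u₁, u₂] : Fin 3 → ℝ), (0 : Fin 3 → ℝ)), ((0 : Fin 3 → ℝ), (0 : Fol L → Fin 3 → ℝ))) : GnoCoord L) +
            s • ((((![d.1, 0, 0] : Fin 3 → ℝ), d.2.1), (d.2.2.1, d.2.2.2)) : GnoCoord L)))) := by
      rw [key]; linarith only [hfl, hy0, hz0]
    nlinarith [this, h16]
  -- the comparison
  have key := iteratedDeriv_two_ge_of_minorant hφd (contDiff_sq_mul hhd) hmin (by simp [hφ0])
  have h2 : (2 : WithTop ℕ∞) ≤ ∞ := by norm_cast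
  rw [iteratedDeriv_two_sq_mul (hhd.of_le h2)] at key
  have e0 : h 0 = (4 * δ ^ 2 / ‖a.im‖ ^ 2) * (4 * (u₁ ^ 2 + u₂ ^ 2) / (1 + (u₁ ^ 2 + u₂ ^ 2))) / (16200 * (L : ℝ) ^ 6) := by
    simp only [hh, zero_mul, ne_eq, OfNat.ofNat_ne_zero, not_false_eq_true, zero_pow, zero_add]
    have him2 : ‖a.im‖ ^ 2 ≠ 0 := by positivity
    field_simp
  rw [e0] at key
  linarith only [key]
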